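import Mathlib
import HarnessLib
import HarnessLib.Audit
import Summits.HodgeConjecture.HodgeConjecture.Theses.EightfoldTwistedSheafSeeds
import Literature.AlgebraicGeometry.HodgeTheory.SemiregularVariationalHodgeTwistedPerfect
import Literature.AlgebraicGeometry.HodgeTheory.TwistedPerfectAdmissibilityInitialSegment
import Literature.AlgebraicGeometry.HodgeTheory.LefschetzOneOne
import Summits.Ventures.HSemireg.AmplificationChainSigmaGluable

/-!
# Skeleton `Lines/two-doors` for crux `TwistedPerfectDoorPrime` (stmt-HodgeConjecture-20706)

HONEST FRAMING: a crux PROOF SKELETON (cruxes-workfile class), not a proof. The crux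
`Theses.EightfoldTwistedSheafSeeds.TwistedPerfectDoorPrime =
  ∀ C, TwistedPerfectDoorVHC C (gluableSigmaAdmissible ∨ bfSingleAdmissible')`
(the local variational Hodge statement for the twisted-perfect door, keyed on the DISJUNCTIVE admissibility
notion of the route) is NOT proved here: the `sorry`s sit exactly inside the registered `stub_*` declarations.
Nothing here proves rung H2, `WeilSixfolds`, HC_AV or HC.

STRATEGY (line-writer seat `linewriter-hodgeav-h2sheaf` g0, 2026-08-31) — ONE DOOR PER PAPER. Membership in
`twistedReflexiveClass C (A ∨ B)` is membership in `twistedReflexiveClass C A` or in `twistedReflexiveClass C B`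
(the admissibility notion enters the object class through one conjunct, `twistedReflexiveClass.mono`), so the
door for a disjunction of notions is the conjunction of the two doors (`door_or`, PROVED below). The two doors are
two different theorems in print, with different engines:

* `stub_bfTwistedDoor` — `∀ C, TwistedPerfectDoorVHC C bfSingleAdmissible'`: the `B`-twisted Buchweitz–Flenner
  slice WITH the initial-segment conjunct (a single `I`-semiregular vector bundle `E₀`, `κ = exp(B₀)·ch(E₀)`,
  `{q | q+1 ∈ I}` an initial segment, on which twisted and untwisted `I`-semiregularity coincide). `B₀ = 0`:
  [BuchweitzFlenner2003] Thm. 5.1 verbatim (tree fact `BuchweitzFlenner2003_variationalHodge_ISemiregular_model`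
  is its `C`-instance); `B₀ ≠ 0`: [Pridham2024Semiregularity] Rem. 2.26 with Cor. 2.25 (refereed, infinitesimal)
  + Hodge-free algebraisation, or [Perry2026Semiregularity] Thm. 1.1 (2) (preprint; tree fact
  `Perry2026_semiregularTwisted_remainsAlgebraic` is its GLOBAL form). [L/XL]
* `stub_sigmaGluableDoor` — `∀ C, TwistedPerfectDoorVHC C gluableSigmaAdmissible`: the door for universally
  gluable (`Ext^{<0} = 0`) strictly perfect complexes with `(σ_q)_{q+1 ∈ I}` jointly injective and
  `{1,…,n} ⊆ I`: [Pridham2024Semiregularity] Cor. 2.25 + Rem. 2.27 + Rem. 2.21 (reduced obstruction theory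
  `ker σ` over the Hodge locus, any perfect complex; twisted form Rem. 2.26) for the infinitesimal lifts,
  [Lieblich2006] Thm. 4.2.1 + [EGAIV4] 17.14.2 / 17.16.3 (i) + [ThomasonTrobaugh1990] 2.3.1 (d) for the
  algebraisation over an étale neighbourhood (the venture's untwisted split `PridhamPerfectLifts C` +
  `PerfectComplexAlgebraisesLifts C ⟹ PerfectComplexDeformsOverEtaleNbhd C sigmaAdmissible`,
  `AmplificationChainPridhamPerfect.lean`, is the model; the twisted analogue of `PerfectLiftsOverArtinianPointsAt`
  — deformations of a `μ_r`-gerbe-twisted perfect complex — is the foreseen second layer, not typed in the tree).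
  [XL] CAVEAT of record: Markman's `σ_𝓑` vs Pridham's `𝓛` comparison is unverified in print (Markman fn. p. 6).
* `stub_rung_twistedLineBundleDoor` — RUNG (special case, first prover target): the door for the primed BF notion
  restricted to complexes whose degree-`0` term has rank `≤ 1` (twisted LINE BUNDLES: `κ = exp(B₀ + c₁(L))`).
  Decided in print WITHOUT deformation theory: `1 ∈ I` whenever `I ≠ ∅` (initial segment), so `κ₁ = B₀ + c₁(L)`
  stays a rational `(1,1)` class, hence a divisor class on every nearby fibre (Lefschetz (1,1), tree fact
  `lefschetzOneOne_rational`), and `κ_p = κ₁^p/p!` is algebraic (`algebraicClasses` is multiplicative). Outside the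
  tree's proved regime (no cell of `TwistedPerfectDoorVHC` is proved in the tree). `rung_of_crux` (sorry-free)
  shows it IS a special case of the crux.

COMPOSITION `TwistedPerfectDoorPrime_of` (sorry-free given the stubs): `door_or (stub_sigmaGluableDoor C)
(stub_bfTwistedDoor C)`.

References: [BuchweitzFlenner2003] §5 Thm. 5.1, Def. 4.1; [Pridham2024Semiregularity] Cor. 2.25, Rem. 2.21,
2.26, 2.27, Lemma 1.8–1.9; [Perry2026Semiregularity] Thm. 1.1 (2); [Lieblich2006] Thm. 4.2.1; [Markman2025SecantWeil]
§7.3 statement 7.3.9, §7.5.2, footnote p. 6; [VoisinHodgeI2002] Thm. 11.30 (Lefschetz (1,1)).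
-/

-- every declaration of this problem lives in `Summit.HodgeConjecture.HodgeConjecture.…` (summit = sub-problem)
set_option linter.dupNamespace false

noncomputable section

open CategoryTheory CategoryTheory.Limits AlgebraicGeometry
open Literature.AlgebraicGeometry.Motives Literature.AlgebraicGeometry.HodgeTheory
open Summit.Ventures.HSemireg

namespace Summit.HodgeConjecture.HodgeConjecture.Cruxes.TwistedPerfectDoorPrime.TwoDoors

/-- **The door for a disjunction of admissibility notions is the conjunction of the doors** (PROVED): membership
in `twistedReflexiveClass C (A ∨ B)` is witnessed by one complex, admissible for `A` or for `B`.
[cite: BuchweitzFlenner2003, §5 Thm. 5.1 (binder shape)] -/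
theorem door_or {C : ChernCharacterBetti} {A B : PerfectAdmissibility}
    (hA : TwistedPerfectDoorVHC C A) (hB : TwistedPerfectDoorVHC C B) :
    TwistedPerfectDoorVHC C (fun n X₀ I E => A n X₀ I E ∨ B n X₀ I E) := by
  intro 𝒳 S π n hπ hS U hU s₀ X₀ e I κ hκ hHodge
  obtain ⟨E, hE, B₀, hAB, hBr, hBa, hκ'⟩ := hκ
  rcases hAB with h | h
  · exact hA π n hπ hS hU s₀ X₀ e I κ ⟨E, hE, B₀, h, hBr, hBa, hκ'⟩ hHodge
  · exact hB π n hπ hS hU s₀ X₀ e I κ ⟨E, hE, B₀, h, hBr, hBa, hκ'⟩ hHodge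

/-- STUB (open, load-bearing, L/XL): the `B`-twisted Buchweitz–Flenner door with the initial-segment conjunct,
in every Chern character theory. [cite: BuchweitzFlenner2003, §5 Thm. 5.1]
[cite: Pridham2024Semiregularity, Rem. 2.26 with Cor. 2.25] [cite: Perry2026Semiregularity, Thm. 1.1 (2)] -/
theorem stub_bfTwistedDoor : ∀ C : ChernCharacterBetti, TwistedPerfectDoorVHC C bfSingleAdmissible' := by
  sorry

/-- STUB (open, load-bearing, XL): the door for universally gluable `I`-semiregular strictly perfect complexes
(Pridham's reduced obstruction theory + Lieblich's stack + étale quasi-section + strictification), in every Chern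
character theory. [cite: Pridham2024Semiregularity, Cor. 2.25, Rem. 2.26 and Rem. 2.27] [cite: Lieblich2006, Thm. 4.2.1]
[cite: ThomasonTrobaugh1990, Prop. 2.3.1 (d)] -/
theorem stub_sigmaGluableDoor : ∀ C : ChernCharacterBetti, TwistedPerfectDoorVHC C gluableSigmaAdmissible := by
  sorry

/-- The primed Buchweitz–Flenner notion restricted to twisted LINE BUNDLES (degree-`0` term of rank `≤ 1`). -/
def bfLineAdmissible : PerfectAdmissibility := fun n X₀ I E =>
  bfSingleAdmissible' n X₀ I E ∧ HasRankLE (E.X 0) 1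

/-- RUNG STUB (open, first prover target, M/L): the door for `B`-twisted semiregular LINE BUNDLES, in every Chern
character theory — decided in print by Lefschetz (1,1) on the nearby fibres (`κ₁ = B₀ + c₁(L)` stays a rational
`(1,1)` class since `1 ∈ I`; `κ_p = κ₁^p / p!`). [cite: VoisinHodgeI2002, Thm. 11.30] [cite: KodairaSpencer1959, Thm. (stability of divisors)] -/
theorem stub_rung_twistedLineBundleDoor : ∀ C : ChernCharacterBetti, TwistedPerfectDoorVHC C bfLineAdmissible := by
  sorry

/-- Remark (sorry-free): the rung IS the crux restricted to twisted line bundles (antitonicity of the door in the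
notion). -/
theorem rung_of_crux
    (h : Summit.HodgeConjecture.HodgeConjecture.Theses.EightfoldTwistedSheafSeeds.TwistedPerfectDoorPrime) :
    ∀ C : ChernCharacterBetti, TwistedPerfectDoorVHC C bfLineAdmissible :=
  fun C => (h C).anti fun _ _ _ _ hE => Or.inr hE.1

/-- **Composition** (the ONLY theorem of this file concluding the crux): the stubs give
`TwistedPerfectDoorPrime` BY NAME. -/
theorem TwistedPerfectDoorPrime_of :
    Summit.HodgeConjecture.HodgeConjecture.Theses.EightfoldTwistedSheafSeeds.TwistedPerfectDoorPrime :=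
  fun C => door_or (stub_sigmaGluableDoor C) (stub_bfTwistedDoor C)

end Summit.HodgeConjecture.HodgeConjecture.Cruxes.TwistedPerfectDoorPrime.TwoDoors

end
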